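import Literature.Analysis.FluidPDE.LocalLeraySlabPairing
import Literature.Analysis.FluidPDE.NSWeakProductRuleSobolev
import Literature.Analysis.FluidPDE.WeakGradientSlicing
import Literature.Analysis.FluidPDE.LeraySeparationOfEnergyTools
import HarnessLib

/-!
# Local Leray solutions on a slab: good time slices, and the pairing identity in weak form

Analysis/FluidPDE theorem file (no new definitions) over the slab class
`IsLocalLeraySolutionOn T ν v₀ v π` (`LocalLeraySolutionsSlab.lean`), second file of the
weak–strong ingredient of Lemarié-Rieusset 2016, Thm. 14.7 (the balance of `u₁·u₂`, file
p. 515). The time-doubling argument works with the slices `u(σ, ·)` of the two solutions as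
fixed `H¹_loc` fields; this file records that almost every slice is such a field and rewrites
the nonlinear term of the pairing identity in the form that survives for `H¹` test fields.

* `HasWeakSpatialGradientOn.ae_hasWeakFDerivOn_slice_slab` — for a weak spatial gradient `G` of
  `v` on the slab `(0,T) × ℝ³`, for a.e. `t` the slice `G t` is the weak derivative of `v t` on
  `ℝ³` (the accepted `ae_hasWeakFDerivOn_slice`, Caffarelli–Kohn–Nirenberg 1982, (2.8)–(2.10):
  "for almost every `t`");
* `IsLocalLeraySolutionOn.ae_trace_slice_eq_zero` — for a.e. `t`, `tr G t = 0` a.e. in `x`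
  (`SerrinBoundedHolder.ae_trace_eq_zero` and Fubini);
* `IsLocalLeraySolutionOn.ae_lintegral_grad_sq_ball_lt_top` — for a.e. `t`, `G t ∈ L²(B(0,n))`
  for every `n` (Tonelli on the cylinders of clause (2));
* `IsLocalLeraySolutionOn.ae_integral_inner_convect_slice_eq_neg` — **the nonlinear term in weak
  form at a.e. slice**: for `φ ∈ C_c^∞(ℝ³; ℝ³)` and a.e. `t ∈ (0,T)`,
  `∫ ⟪v(t), (v(t)·∇)φ⟫ = -∫ ⟪G(t) v(t), φ⟫` (the `W^{1,2}` product rule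
  `setIntegral_inner_fderiv_apply_self_eq_neg_of_sq` on a ball containing `supp φ`);
* `IsLocalLeraySolutionOn.ae_pairing_eq_datum_add_weak` — **the pairing identity from the
  initial time in weak form** (Lemarié-Rieusset 2016, Prop. 14.1 and proof of Thm. 14.7, p. 515:
  `∂ₜ∫u·φ = -∫((u·∇)u)·φ - ν∫∇u:∇φ + ∫p div φ`): for a.e. `t ∈ (0,T)`,
  `∫ ⟪v(t), φ⟫ = ∫ ⟪v₀, φ⟫ + ∫_{(0,t]} ( -∫ ⟪G v, φ⟫ + ∫ π div φ - ν ∫ ∑ᵢ ⟪G eᵢ, ∂ᵢφ⟫ )`,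
  every term of which makes sense for `φ = ψ w`, `w ∈ H¹_loc ∩ L⁶_loc` (the density step of
  the doubling argument).

## Mathlib / tree search

Tree: `HasWeakSpatialGradientOn.ae_hasWeakFDerivOn_slice` (`WeakGradientSlicing`),
`SerrinBoundedHolder.ae_trace_eq_zero` (`NSBoundedSpatialHolder`),
`setIntegral_inner_fderiv_apply_self_eq_neg_of_sq` (`NSWeakProductRuleSobolev`),
`IsLocalLeraySolutionOn.ae_pairing_eq_datum_add_grad` (`LocalLeraySlabPairing`),
`HasWeakFDerivOn.mono_set_holds`, `enorm_opNorm_sq_le_ofReal_frobeniusNormSq`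
(`LeraySeparationOfEnergyTools`), `HasWeakSpatialGradientOn.ae_eq`, `volume_restrict_slab_eq`,
`ae_slice_aestronglyMeasurable_and_lintegral_ball_lt_top`. Mathlib: `Measure.ae_ae_of_ae_prod`,
`lintegral_prod`, `ae_lt_top'`.

## References

* P. G. Lemarié-Rieusset, *The Navier–Stokes Problem in the 21st Century*, CRC Press 2016,
  doi:10.1201/b19556: Prop. 14.1 (p. 498); Thm. 14.7, proof, p. 515. [LemarieRieusset2016]
* L. Caffarelli, R. Kohn, L. Nirenberg, Comm. Pure Appl. Math. 35 (1982), §2, (2.1),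
  (2.8)–(2.10). [CaffarelliKohnNirenberg1982]
* D. Gilbarg, N. S. Trudinger, *Elliptic PDE of second order* (2001), (7.18). [GilbargTrudinger2001]
-/

noncomputable section

open MeasureTheory TopologicalSpace Set Function Filter Metric
open _root_.Topology
open scoped ENNReal NNReal RealInnerProductSpace Laplacian

namespace Literature.Analysis.FluidPDE

open BradshawTsai2019

/-- **Slices of a weak spatial gradient on a slab are weak derivatives on the whole space.** For a
weak spatial gradient `G` of `v` on the slab `(a,b) × E`, for a.e. `t ∈ (a,b)` the slice `G t` is
the weak derivative of `v t` on `E` (`HasWeakFDerivOn ⊤`; the accepted `ae_hasWeakFDerivOn_slice`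
with `Ω = ⊤`). The slab `slab E (Ioo a b) _` is by definition the product open set `(a,b) ×ˢ ⊤`, so
this is literally `HasWeakSpatialGradientOn.ae_hasWeakFDerivOn_slice` (`WeakGradientSlicing.lean`);
the name is kept for its 7 users. [cite: CaffarelliKohnNirenberg1982, §2 (2.1), (2.8)–(2.10)] -/
theorem HasWeakSpatialGradientOn.ae_hasWeakFDerivOn_slice_slab {E : Type*} [NormedAddCommGroup E]
    [InnerProductSpace ℝ E] [FiniteDimensional ℝ E] [MeasurableSpace E] [BorelSpace E]
    {a b : ℝ} {v : ℝ → E → E} {G : ℝ → E → E →L[ℝ] E}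
    (hG : HasWeakSpatialGradientOn (slab E (Ioo a b) isOpen_Ioo) v G) :
    ∀ᵐ t ∂((volume : Measure ℝ).restrict (Ioo a b)),
      FunctionSpaces.HasWeakFDerivOn (⊤ : Opens E) volume (v t) (G t) :=
  hG.ae_hasWeakFDerivOn_slice

namespace IsLocalLeraySolutionOn

variable {T ν : ℝ} {v₀ : EuclideanSpace ℝ (Fin 3) → EuclideanSpace ℝ (Fin 3)}
  {v : ℝ → EuclideanSpace ℝ (Fin 3) → EuclideanSpace ℝ (Fin 3)}
  {π : ℝ → EuclideanSpace ℝ (Fin 3) → ℝ}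

/-- **Almost every slice of the gradient has vanishing trace** (`div v(t) = 0` as the trace of
the weak gradient): for a.e. `t ∈ (0,T)`, `∑ⱼ (G t x eⱼ)ⱼ = 0` for a.e. `x`
(`SerrinBoundedHolder.ae_trace_eq_zero` on the slab, then Fubini). [folklore] -/
theorem ae_trace_slice_eq_zero (h : IsLocalLeraySolutionOn T ν v₀ v π)
    {G : ℝ → EuclideanSpace ℝ (Fin 3) → EuclideanSpace ℝ (Fin 3) →L[ℝ] EuclideanSpace ℝ (Fin 3)}
    (hG : HasWeakSpatialGradientOn (slab (EuclideanSpace ℝ (Fin 3)) (Ioo 0 T) isOpen_Ioo) v G) :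
    ∀ᵐ t ∂((volume : Measure ℝ).restrict (Ioo 0 T)), ∀ᵐ x ∂(volume : Measure (EuclideanSpace ℝ (Fin 3))),
      ∑ j, G t x (EuclideanSpace.single j (1 : ℝ)) j = 0 := by
  have h1 := SerrinBoundedHolder.ae_trace_eq_zero h.distributional hG
  have h2 : ∀ᵐ w ∂(volume.restrict (Ioo (0 : ℝ) T ×ˢ (univ : Set (EuclideanSpace ℝ (Fin 3))))),
      ∑ j, G w.1 w.2 (EuclideanSpace.single j (1 : ℝ)) j = 0 := by
    rw [ae_restrict_iff' (measurableSet_Ioo.prod MeasurableSet.univ)]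
    filter_upwards [h1] with w hw hmem
    exact hw (mem_slab.2 hmem.1)
  rw [volume_restrict_slab_eq] at h2
  exact Measure.ae_ae_of_ae_prod h2

/-- **Almost every slice of the gradient is square integrable on every ball.** For a.e.
`t ∈ (0,T)`, `∫_{B(0,n)} ‖G t‖² < ∞` for all `n` (the uniform cylinder bounds of clause (2) for
the class gradient, a.e. uniqueness of weak gradients, `‖L‖² ≤ |L|²_F`, and Tonelli). [folklore] -/
theorem ae_lintegral_grad_sq_ball_lt_top (h : IsLocalLeraySolutionOn T ν v₀ v π)
    {G : ℝ → EuclideanSpace ℝ (Fin 3) → EuclideanSpace ℝ (Fin 3) →L[ℝ] EuclideanSpace ℝ (Fin 3)}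
    (hG : HasWeakSpatialGradientOn (slab (EuclideanSpace ℝ (Fin 3)) (Ioo 0 T) isOpen_Ioo) v G) :
    ∀ᵐ t ∂((volume : Measure ℝ).restrict (Ioo 0 T)),
      ∀ n : ℕ, ∫⁻ x in ball (0 : EuclideanSpace ℝ (Fin 3)) n, ‖G t x‖ₑ ^ 2 < ∞ := by
  obtain ⟨G', hG', hG'b⟩ := h.uniformLocalGradient
  have hslab : ((slab (EuclideanSpace ℝ (Fin 3)) (Ioo 0 T) isOpen_Ioo :
      Opens (ℝ × EuclideanSpace ℝ (Fin 3))) : Set (ℝ × EuclideanSpace ℝ (Fin 3))) =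
      Ioo (0 : ℝ) T ×ˢ univ := rfl
  have hGm : AEStronglyMeasurable (uncurry G)
      (volume.restrict (Ioo (0 : ℝ) T ×ˢ (univ : Set (EuclideanSpace ℝ (Fin 3))))) := by
    rw [← hslab]; exact hG.locallyIntegrableOn_grad.aestronglyMeasurable
  have hae : ∀ᵐ z ∂(volume.restrict (Ioo (0 : ℝ) T ×ˢ (univ : Set (EuclideanSpace ℝ (Fin 3))))),
      uncurry G z = uncurry G' z := by
    have h1 := hG.ae_eq hG'
    rwa [hslab] at h1
  have hfin : ∀ n : ℕ, ∫⁻ z in Ioo (0 : ℝ) T ×ˢ ball (0 : EuclideanSpace ℝ (Fin 3)) n,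
      ‖uncurry G z‖ₑ ^ 2 < ∞ := by
    intro n
    obtain ⟨C, hC⟩ := hG'b ((n : ℝ) + 1) (by positivity)
    have hsub : Ioo (0 : ℝ) T ×ˢ ball (0 : EuclideanSpace ℝ (Fin 3)) n ⊆
        Ioo 0 T ×ˢ ball (0 : EuclideanSpace ℝ (Fin 3)) ((n : ℝ) + 1) :=
      prod_mono Subset.rfl (ball_subset_ball (by linarith))
    have haeB : ∀ᵐ z ∂(volume.restrict (Ioo (0 : ℝ) T ×ˢ ball (0 : EuclideanSpace ℝ (Fin 3)) ((n : ℝ) + 1))),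
        uncurry G z = uncurry G' z :=
      ae_restrict_of_ae_restrict_of_subset (prod_mono Subset.rfl (subset_univ _)) hae
    calc ∫⁻ z in Ioo (0 : ℝ) T ×ˢ ball (0 : EuclideanSpace ℝ (Fin 3)) n, ‖uncurry G z‖ₑ ^ 2
        ≤ ∫⁻ z in Ioo (0 : ℝ) T ×ˢ ball (0 : EuclideanSpace ℝ (Fin 3)) ((n : ℝ) + 1), ‖uncurry G z‖ₑ ^ 2 :=
          lintegral_mono_set hsub
      _ ≤ ∫⁻ z in Ioo (0 : ℝ) T ×ˢ ball (0 : EuclideanSpace ℝ (Fin 3)) ((n : ℝ) + 1),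
            ENNReal.ofReal (frobeniusNormSq (G' z.1 z.2)) := by
          refine lintegral_mono_ae ?_
          filter_upwards [haeB] with z hz
          rw [hz]
          exact enorm_opNorm_sq_le_ofReal_frobeniusNormSq (G' z.1 z.2)
      _ < ∞ := (hC 0).trans_lt ENNReal.coe_lt_top
  -- Tonelli for each `n`
  have h2 : ∀ n : ℕ, ∀ᵐ t ∂((volume : Measure ℝ).restrict (Ioo 0 T)),
      ∫⁻ x in ball (0 : EuclideanSpace ℝ (Fin 3)) n, ‖G t x‖ₑ ^ 2 < ∞ := by
    intro n
    have hf := hfin n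
    rw [show (volume : Measure (ℝ × EuclideanSpace ℝ (Fin 3))).restrict
        (Ioo 0 T ×ˢ ball (0 : EuclideanSpace ℝ (Fin 3)) n) =
        ((volume : Measure ℝ).restrict (Ioo 0 T)).prod
          ((volume : Measure (EuclideanSpace ℝ (Fin 3))).restrict (ball (0 : EuclideanSpace ℝ (Fin 3)) n)) by
      rw [Measure.volume_eq_prod, Measure.prod_restrict]] at hf
    have hle : ((volume : Measure ℝ).restrict (Ioo 0 T)).prod
        ((volume : Measure (EuclideanSpace ℝ (Fin 3))).restrict (ball (0 : EuclideanSpace ℝ (Fin 3)) n)) ≤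
        ((volume : Measure ℝ).restrict (Ioo 0 T)).prod (volume : Measure (EuclideanSpace ℝ (Fin 3))) :=
      Measure.prod_mono le_rfl Measure.restrict_le_self
    have hGm' : AEStronglyMeasurable (uncurry G)
        (((volume : Measure ℝ).restrict (Ioo 0 T)).prod (volume : Measure (EuclideanSpace ℝ (Fin 3)))) := by
      rwa [volume_restrict_slab_eq] at hGm
    have hm : AEMeasurable (fun z : ℝ × EuclideanSpace ℝ (Fin 3) => ‖uncurry G z‖ₑ ^ 2)
        (((volume : Measure ℝ).restrict (Ioo 0 T)).prod
          ((volume : Measure (EuclideanSpace ℝ (Fin 3))).restrict (ball (0 : EuclideanSpace ℝ (Fin 3)) n))) :=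
      (hGm'.mono_measure hle).aemeasurable.enorm.pow_const 2
    rw [lintegral_prod _ hm] at hf
    filter_upwards [ae_lt_top' hm.lintegral_prod_right' hf.ne] with t ht
    exact ht
  rw [← ae_all_iff] at h2
  exact h2

/-- **The nonlinear term in weak form at a.e. slice**: for a local Leray solution on
`(0,T) × ℝ³`, a weak spatial gradient `G` of `v` on the slab and `φ ∈ C_c^∞(ℝ³; ℝ³)`, for a.e.
`t ∈ (0,T)`, `∫ ⟪v(t), (v(t)·∇)φ⟫ = -∫ ⟪G(t) v(t), φ⟫` — the identification
`u·div(u ⊗ u)·φ`-wise of `-div (v ⊗ v)` with `-(v·∇)v` for the `H¹_loc` slices (Lemarié-Rieusset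
2016, proof of Thm. 14.7, p. 515), by the `W^{1,2}` product rule
`setIntegral_inner_fderiv_apply_self_eq_neg_of_sq` on a ball containing `supp φ` at the good
times of the three preceding lemmas. [cite: LemarieRieusset2016, Thm. 14.7 proof (file p. 515); GilbargTrudinger2001 (7.18)] -/
theorem ae_integral_inner_convect_slice_eq_neg (h : IsLocalLeraySolutionOn T ν v₀ v π)
    {G : ℝ → EuclideanSpace ℝ (Fin 3) → EuclideanSpace ℝ (Fin 3) →L[ℝ] EuclideanSpace ℝ (Fin 3)}
    (hG : HasWeakSpatialGradientOn (slab (EuclideanSpace ℝ (Fin 3)) (Ioo 0 T) isOpen_Ioo) v G)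
    {φ : EuclideanSpace ℝ (Fin 3) → EuclideanSpace ℝ (Fin 3)}
    (hφ : FunctionSpaces.IsTestFunctionOn (⊤ : Opens (EuclideanSpace ℝ (Fin 3))) φ) :
    ∀ᵐ t ∂((volume : Measure ℝ).restrict (Ioo 0 T)),
      ∫ x, ⟪v t x, convect (v t) φ x⟫ = -∫ x, ⟪G t x (v t x), φ x⟫ := by
  -- a ball containing the support of `φ`
  obtain ⟨r, hr⟩ := hφ.hasCompactSupport.isCompact.isBounded.subset_ball (0 : EuclideanSpace ℝ (Fin 3))
  set n : ℕ := ⌈max r 1⌉₊ with hn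
  have hrn : r ≤ n := (le_max_left r 1).trans (Nat.le_ceil _)
  have hKB : tsupport φ ⊆ ball (0 : EuclideanSpace ℝ (Fin 3)) n := hr.trans (ball_subset_ball hrn)
  have hφB : FunctionSpaces.IsTestFunctionOn
      (⟨ball (0 : EuclideanSpace ℝ (Fin 3)) n, isOpen_ball⟩ : Opens (EuclideanSpace ℝ (Fin 3))) φ :=
    ⟨hφ.contDiff, hφ.hasCompactSupport, hKB⟩
  have hφ0 : ∀ x, x ∉ tsupport φ → φ x = 0 := fun x hx => image_eq_zero_of_notMem_tsupport hx
  have hD0 : ∀ x, x ∉ tsupport φ → fderiv ℝ φ x = 0 := fun x hx => fderiv_of_notMem_tsupport ℝ hx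
  -- good slices
  have hmeas : AEStronglyMeasurable (uncurry v)
      ((volume : Measure (ℝ × EuclideanSpace ℝ (Fin 3))).restrict (Ioo 0 T ×ˢ univ)) :=
    h.aestronglyMeasurable
  have hsq : ∀ K' : Set (EuclideanSpace ℝ (Fin 3)), IsCompact K' →
      ∫⁻ z in Ioo 0 T ×ˢ K', ‖uncurry v z‖ₑ ^ 2 < ∞ := fun K' hK' => h.sqIntegrable K' hK'
  have hgood := ae_slice_aestronglyMeasurable_and_lintegral_ball_lt_top hmeas hsq
  filter_upwards [hgood, hG.ae_hasWeakFDerivOn_slice_slab, h.ae_trace_slice_eq_zero hG,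
    h.ae_lintegral_grad_sq_ball_lt_top hG] with t h1 h2 h3 h4
  -- the product rule on the ball
  have hw : FunctionSpaces.HasWeakFDerivOn
      (⟨ball (0 : EuclideanSpace ℝ (Fin 3)) n, isOpen_ball⟩ : Opens (EuclideanSpace ℝ (Fin 3))) volume (v t) (G t) :=
    FunctionSpaces.HasWeakFDerivOn.mono_set_holds h2 le_top
  have hv2 : ∫⁻ x in ball (0 : EuclideanSpace ℝ (Fin 3)) n, ‖v t x‖ₑ ^ 2 < ∞ :=
    (lintegral_mono_set ball_subset_closedBall).trans_lt (h1.2 n)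
  have key := setIntegral_inner_fderiv_apply_self_eq_neg_of_sq hw hv2 (h4 n) (ae_restrict_of_ae h3) hφB
  -- pass from the ball to the whole space
  have e1 : ∫ x in ball (0 : EuclideanSpace ℝ (Fin 3)) n, ⟪v t x, fderiv ℝ φ x (v t x)⟫ =
      ∫ x, ⟪v t x, convect (v t) φ x⟫ := by
    refine setIntegral_eq_integral_of_forall_compl_eq_zero fun x hx => ?_
    rw [hD0 x (fun h' => hx (hKB h'))]
    simp
  have e2 : ∫ x in ball (0 : EuclideanSpace ℝ (Fin 3)) n, ⟪G t x (v t x), φ x⟫ =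
      ∫ x, ⟪G t x (v t x), φ x⟫ := by
    refine setIntegral_eq_integral_of_forall_compl_eq_zero fun x hx => ?_
    rw [hφ0 x (fun h' => hx (hKB h')), inner_zero_right]
  rw [e1, e2] at key
  exact key

/-- **The pairing identity from the initial time in weak form, at a.e. slice** (Lemarié-Rieusset
2016, Prop. 14.1 and proof of Thm. 14.7, p. 515: "`∂ₜ∫u·φ = ν∫u·Δφ + ∫u⊗u·∇⊗φ + ∫p div φ`",
here with `∫u⊗u·∇⊗φ = -∫((u·∇)u)·φ` and `ν∫u·Δφ = -ν∫∇u:∇φ`). For a local Leray solution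
`(v, π)` on `(0,T) × ℝ³`, `T > 0`, with measurable datum `v₀`, a weak spatial gradient `G` of
`v` on the slab, every `φ ∈ C_c^∞(ℝ³; ℝ³)` and a.e. `t ∈ (0,T)`:
`∫ ⟪v(t), φ⟫ = ∫ ⟪v₀, φ⟫ + ∫_{(0,t]} ( (-∫ ⟪G v, φ⟫ + ∫ π div φ) - ν ∫ ∑ᵢ ⟪G eᵢ, ∂ᵢφ⟫ )`.
[cite: LemarieRieusset2016, Prop. 14.1 (file p. 498) and Thm. 14.7 proof (p. 515)] -/
theorem ae_pairing_eq_datum_add_weak (h : IsLocalLeraySolutionOn T ν v₀ v π) (hT : 0 < T)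
    (hm₀ : AEStronglyMeasurable v₀ volume)
    {G : ℝ → EuclideanSpace ℝ (Fin 3) → EuclideanSpace ℝ (Fin 3) →L[ℝ] EuclideanSpace ℝ (Fin 3)}
    (hG : HasWeakSpatialGradientOn (slab (EuclideanSpace ℝ (Fin 3)) (Ioo 0 T) isOpen_Ioo) v G)
    {φ : EuclideanSpace ℝ (Fin 3) → EuclideanSpace ℝ (Fin 3)}
    (hφ : FunctionSpaces.IsTestFunctionOn (⊤ : Opens (EuclideanSpace ℝ (Fin 3))) φ) :
    ∀ᵐ t ∂((volume : Measure ℝ).restrict (Ioo 0 T)),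
      ∫ x, ⟪v t x, φ x⟫ = (∫ x, ⟪v₀ x, φ x⟫) +
        ∫ s in Ioc 0 t, (((-∫ x, ⟪G s x (v s x), φ x⟫) + ∫ x, π s x * VectorCalculus.divergence φ x) -
          ν * ∫ x, ∑ i, ⟪G s x (stdOrthonormalBasis ℝ (EuclideanSpace ℝ (Fin 3)) i),
            fderiv ℝ φ x (stdOrthonormalBasis ℝ (EuclideanSpace ℝ (Fin 3)) i)⟫) := by
  set K : Set (EuclideanSpace ℝ (Fin 3)) := tsupport φ with hK_def
  have hK : IsCompact K := hφ.hasCompactSupport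
  have hφd : Differentiable ℝ φ := hφ.contDiff.differentiable (by simp)
  have cD : Continuous (fderiv ℝ φ) := hφ.contDiff.continuous_fderiv (by simp)
  have cdiv : Continuous (VectorCalculus.divergence φ) := by
    have : VectorCalculus.divergence φ = fun x => ∑ i, ⟪stdOrthonormalBasis ℝ (EuclideanSpace ℝ (Fin 3)) i,
        fderiv ℝ φ x (stdOrthonormalBasis ℝ (EuclideanSpace ℝ (Fin 3)) i)⟫ := by
      funext x
      exact divergence_eq_sum_inner_fderiv (stdOrthonormalBasis ℝ (EuclideanSpace ℝ (Fin 3))) φ x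
    rw [this]
    exact continuous_finsetSum _ fun i _ => continuous_const.inner (cD.clm_apply continuous_const)
  have hD0 : ∀ x, x ∉ K → fderiv ℝ φ x = 0 := fun x hx => fderiv_of_notMem_tsupport ℝ hx
  have hdiv0 : ∀ x, x ∉ K → VectorCalculus.divergence φ x = 0 := fun x hx => by
    simp [VectorCalculus.divergence, hD0 x hx]
  -- slice integrability of the two surviving integrands, for a.e. `s`
  obtain ⟨hUK1, hUK2⟩ := h.integrableOn_velocity hK
  have iX : Integrable (fun z : ℝ × EuclideanSpace ℝ (Fin 3) => ⟪v z.1 z.2, convect (v z.1) φ z.2⟫)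
      (((volume : Measure ℝ).restrict (Ioo 0 T)).prod (volume : Measure (EuclideanSpace ℝ (Fin 3)))) :=
    integrable_slab_inner_clm_apply (A := fun z : ℝ × EuclideanSpace ℝ (Fin 3) => fderiv ℝ φ z.2) hK hUK1 hUK2
      (cD.comp continuous_snd) fun t x hx => hD0 x hx
  have iP : Integrable (fun z : ℝ × EuclideanSpace ℝ (Fin 3) => π z.1 z.2 * VectorCalculus.divergence φ z.2)
      (((volume : Measure ℝ).restrict (Ioo 0 T)).prod (volume : Measure (EuclideanSpace ℝ (Fin 3)))) :=
    integrable_slab_mul (g := fun z : ℝ × EuclideanSpace ℝ (Fin 3) => VectorCalculus.divergence φ z.2) hK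
      (h.integrableOn_pressure hK) (cdiv.comp continuous_snd) fun t x hx => hdiv0 x hx
  have hsX : ∀ᵐ s ∂((volume : Measure ℝ).restrict (Ioo 0 T)),
      Integrable (fun x => ⟪v s x, convect (v s) φ x⟫) (volume : Measure (EuclideanSpace ℝ (Fin 3))) :=
    iX.prod_right_ae
  have hsP : ∀ᵐ s ∂((volume : Measure ℝ).restrict (Ioo 0 T)),
      Integrable (fun x => π s x * VectorCalculus.divergence φ x) (volume : Measure (EuclideanSpace ℝ (Fin 3))) :=
    iP.prod_right_ae
  have hsplit : ∀ᵐ s ∂((volume : Measure ℝ).restrict (Ioo 0 T)),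
      ∫ x, (⟪v s x, convect (v s) φ x⟫ + π s x * VectorCalculus.divergence φ x) =
        (-∫ x, ⟪G s x (v s x), φ x⟫) + ∫ x, π s x * VectorCalculus.divergence φ x := by
    filter_upwards [hsX, hsP, h.ae_integral_inner_convect_slice_eq_neg hG hφ] with s hX hP hconv
    rw [integral_add hX hP, hconv]
  have hsplit' := (ae_restrict_iff' measurableSet_Ioo).1 hsplit
  filter_upwards [h.ae_pairing_eq_datum_add_grad hT hm₀ hG hφ, ae_restrict_mem measurableSet_Ioo]
    with t ht htI
  rw [ht]
  congr 1
  refine setIntegral_congr_ae measurableSet_Ioc ?_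
  filter_upwards [hsplit'] with s hs hsI
  rw [hs ⟨hsI.1, lt_of_le_of_lt hsI.2 htI.2⟩]

end IsLocalLeraySolutionOn

end Literature.Analysis.FluidPDE
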